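import Literature.Analysis.FunctionSpaces.TorusFourierSynthesis
import Literature.Analysis.FunctionSpaces.TorusCalculus
import Literature.LinearAlgebra.Alternating.WedgeOne
import Mathlib.Analysis.Calculus.DifferentialForm.Basic
import Mathlib.MeasureTheory.Constructions.Pi
import HarnessLib

/-!
# Fibrewise averaging of differential forms on the flat torus `T^{ι₁} × T^{ι₂}` along `T^{ι₁}` is
# chain-homotopic to the identity, by a `C^∞(T^{ι₂})`-linear Fourier-multiplier homotopy

Analysis/FunctionSpaces support file (everything proved; definitions with bodies, no named fact).
This is the de Rham ENGINE behind Freitag's computation of the cohomology of the cusp stabiliser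
`Γ_∞` of a Hilbert modular group (Freitag 1990, Ch. III §2, Prop. 2.1, proof pp. 144–145: `Hⁿ/Γ_∞` is a
torus bundle, «a differential form is harmonic … iff the coefficients do not depend on `x`»; here the
Hodge-theoretic step «harmonic ⇒ independent of the torus variable `x`» is replaced by an explicit chain
homotopy between a form and its average over the torus fibre, which — unlike the straight-line homotopy
of a translation averaged over a fundamental domain — is built from CANONICAL data (a weight vector `W_k`
per Fourier mode) and is therefore equivariant under every symmetry preserving those data; this is what
the sequel `…HilbertModularCuspStabilizerFibreAveraging` uses to average `Γ_∞`-invariant forms on `ℍⁿ`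
over `x ∈ ℝⁿ/t` equivariantly for the multipliers `ε²`).

Differential `p`-forms on the flat torus `T^d = UnitAddTorus d` are smooth functions
`G : T^d → (ℝ^d [⋀^Fin p]→L[ℝ] ℂ)` (`ℝ^d = EuclideanSpace ℝ d` the tangent space; the periodic lift
`Torus.lift G` is then a differential form on `ℝ^d` in the sense of Mathlib's `extDeriv`).  Contents:

* §1 **the exterior derivative on the torus** `Torus.extD G x = alternatizeUncurryFin (Torus.fderiv G x)`,
  `= extDeriv (lift G)` on the cover (`extDeriv_lift`, `lift_extD`), smooth for smooth `G`, equal to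
  `Σ_j dy_j ∧ ∂_j G` (`extD_eq_sum_wedgeOne`, the tree's `wedgeOne` of `LinearAlgebra/Alternating/WedgeOne`),
  and its FOURIER COEFFICIENTS **`mFourierCoeff_extD`: `𝓕(dG)(k) = 2πi · (k♭ ∧ 𝓕G(k))`**, `k♭ = Σ_j k_j dy_j`
  (`freqForm k`), from the tree's `Torus.mFourierCoeff_partialDeriv` (Grafakos 2014, Prop. 3.1.2 (10)).
* §2 on `T^{ι₁ ⊕ ι₂} = T^{ι₁} × T^{ι₂}`, the coefficient operators of a WEIGHT FAMILY
  `W : ℤ^{ι₁} → ℝ^{ι₁ ⊕ ι₂}`: `avgCoeff` (keep the modes `k|ι₁ = 0`), `oscCoeff` (the others),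
  `homCoeff W c k = (2πi)⁻¹ · W_{k|ι₁} ⌟ c k` on the modes `k|ι₁ ≠ 0`, `dCoeff c k = 2πi · k♭ ∧ c k`; rapid decay is
  preserved when `‖W_{k₁}‖` grows at most polynomially; and the COEFFICIENT IDENTITY
  `dCoeff (homCoeff W c) + homCoeff W (dCoeff c) = oscCoeff c` whenever `k♭(W_{k|ι₁}) = 1` on the modes
  `k|ι₁ ≠ 0` — this is Cartan's identity `w ⌟ (θ ∧ η) + θ ∧ (w ⌟ η) = θ(w) η` (the tree's `curryLeft_wedgeOne`,
  Warner 1983, 2.11) mode by mode.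
* §3 the operators on smooth forms: the FIBRE AVERAGE `fibreAvg G = Σ_{k|ι₁ = 0} e_k 𝓕G(k)` and the HOMOTOPY
  `fibreHom W G = Σ_{k|ι₁ ≠ 0} e_k (2πi)⁻¹ W_{k|ι₁} ⌟ 𝓕G(k)` (Fourier syntheses of rapidly decaying families, hence
  smooth: the tree's `Torus.RapidDecay.isSmooth_fourierSynth`), and the MAIN THEOREM
  **`extD_fibreHom_add_fibreHom_extD`: `d(K G) + K(dG) = G − A G`** (both sides smooth with the same Fourier
  coefficients, `IsSmooth.ext_mFourierCoeff`), with `extD_fibreAvg` (`A` is a chain map) and the degree-`0`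
  case `fibreHom_extD_of_degree_zero`.  Consequence: a CLOSED form is its fibre average plus `d` of
  `fibreHom W G` (`eq_fibreAvg_add_extD_fibreHom`).
* §4 the fibre structure: the partial Fourier coefficients `fibreCoeff G k₁ x₂ = ∫_{T^{ι₁}} e_{−k₁}(t) G(t, x₂) dt`,
  Fubini `𝓕G(k₁, k₂) = 𝓕_{ι₂}(fibreCoeff G k₁)(k₂)` (`volume_measurePreserving_sumPiEquivProdPi`), the
  PARTIAL-SYNTHESIS formulas **`fibreAvg_apply`: `(A G)(x₁, x₂) = ∫_{T^{ι₁}} G(t, x₂) dt`** and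
  `fibreHom_apply` (`(K G)(x₁,x₂) = Σ_{k₁ ≠ 0} e_{k₁}(x₁) (2πi)⁻¹ W_{k₁} ⌟ fibreCoeff G k₁ x₂`), whence the
  **`C^∞(T^{ι₂})`-LINEARITY `fibreHom_smul_left`**: `K(φ(x₂) · G) = φ(x₂) · K G` — the homotopy acts fibre by
  fibre (it is this locality that lets the sequel cut off in the non-periodic directions).

Weights.  For the plain de Rham theorem of a torus one may take `W_k = k/|k|²`; for the cusp stabiliser of
a Hilbert modular group the sequel takes the number-field weights `W_ξ = (1/(n σ(ξ)))_σ`, which transform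
like vectors under the multipliers `ε²` and are polynomially bounded because `|N(ξ)|` is bounded below on
the dual lattice.  This file is agnostic: `W` is a parameter subject to `k♭(W_{k|ι₁}) = 1` and polynomial growth.

## References

* [Freitag1990] E. Freitag, *Hilbert Modular Forms*, Springer (1990), Ch. III §2, Prop. 2.1 and its proof,
  pp. 143–145 (the torus bundle `Hⁿ/Γ_∞ → ℝ^{n−1}/log Λ²`, harmonic forms, «the coefficients do not depend on x»).
* [Grafakos2014] L. Grafakos, *Classical Fourier Analysis*, 3rd ed. (2014), Prop. 3.1.2 (10), Prop. 3.2.4,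
  Prop. 3.2.5, Thm. 3.3.9 (coefficients of derivatives; uniqueness; inversion; decay for smooth functions).
* [BottTu1982Forms] R. Bott, L. W. Tu, *Differential Forms in Algebraic Topology* (1982), §I.4 (homotopy
  operators, Poincaré lemma, Künneth for a product with a torus factor by fibre integration).
* [Warner1983] F. W. Warner, *Foundations of Differentiable Manifolds and Lie Groups* (1983), 2.11.
-/

noncomputable section

/- Instance search through `EuclideanSpace ℝ d [⋀^Fin p]→L[ℝ] ℂ` (complex scalars acting on real-alternating
complex-valued maps) nests pending instance problems; as in the Hilbert-modular forms carrier files. -/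
set_option maxSynthPendingDepth 3

open Set Function Filter MeasureTheory UnitAddTorus Complex ContinuousAlternatingMap
open scoped Topology ContDiff BigOperators

namespace Literature.Analysis.FunctionSpaces

namespace Torus

open Literature.LinearAlgebra.Alternating

/-! ## §1 The exterior derivative of a form on the flat torus and its Fourier coefficients -/

section ExtD

variable {d : Type*} [Fintype d] [DecidableEq d]

variable (d) in
/-- Differential `p`-forms on the flat torus `T^d`, as values: continuous real-alternating `p`-forms on the
tangent space `ℝ^d = EuclideanSpace ℝ d` with complex values (the fibre of Mathlib's carrier of `extDeriv` on
`ℝ^d`). [cite: Freitag1990, Ch. III §2, p. 142 («`C^∞`-differential forms of degree `p` on `D`»)] -/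
abbrev DForm (p : ℕ) : Type _ :=
  EuclideanSpace ℝ d [⋀^Fin p]→L[ℝ] ℂ

/-- **The exterior derivative of a `p`-form on the flat torus**: `dG(x) = alternatizeUncurryFin (DG(x))`
(Mathlib's normalisation of `extDeriv`, taken through the torus derivative `Torus.fderiv`).
[cite: Freitag1990, Ch. III §2, p. 142 («`M^p_∞(D) —d→ M^{p+1}_∞(D)`»)] -/
def extD {p : ℕ} (G : UnitAddTorus d → DForm d p) (x : UnitAddTorus d) : DForm d (p + 1) :=
  alternatizeUncurryFin (Torus.fderiv G x)

omit [DecidableEq d] in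
/-- On the cover, `d(lift G) = lift (dG)`: Mathlib's `extDeriv` of the periodic lift is the lift of `Torus.extD`.
[cite: Grafakos2014, §3.1 (functions on `T^n` as periodic functions on `ℝ^n`)] -/
theorem extDeriv_lift {p : ℕ} (G : UnitAddTorus d → DForm d p) (y : EuclideanSpace ℝ d) :
    extDeriv (lift G) y = extD G (proj y) := by
  rw [extDeriv, fderiv_lift]
  rfl

omit [DecidableEq d] in
/-- `lift (dG) = d(lift G)`. [cite: Grafakos2014, §3.1] -/
theorem lift_extD {p : ℕ} (G : UnitAddTorus d → DForm d p) : lift (extD G) = extDeriv (lift G) := by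
  funext y
  rw [lift_apply, extDeriv_lift]

omit [DecidableEq d] in
/-- The exterior derivative of a smooth form on the torus is smooth. [cite: Freitag1990, Ch. III §2, p. 142] -/
theorem IsSmooth.extD {p : ℕ} {G : UnitAddTorus d → DForm d p} (hG : IsSmooth G) : IsSmooth (extD G) := by
  unfold IsSmooth
  rw [lift_extD]
  have h1 : ContDiff ℝ ∞ (_root_.fderiv ℝ (lift G)) := (contDiff_infty_iff_fderiv.1 hG).2
  exact (alternatizeUncurryFinCLM ℝ (EuclideanSpace ℝ d) ℂ (n := p)).contDiff.comp h1

omit [DecidableEq d] in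
/-- `d(dG) = 0` for a smooth form on the torus (Mathlib's `extDeriv_extDeriv` on the cover).
[cite: Freitag1990, Ch. III §2, p. 142 («"complex" means `d·d = 0`»)] -/
theorem extD_extD {p : ℕ} {G : UnitAddTorus d → DForm d p} (hG : IsSmooth G) : extD (extD G) = 0 := by
  apply lift_injective
  have h2 : minSmoothness ℝ 2 ≤ ∞ := by
    rw [minSmoothness_of_isRCLikeNormedField]
    exact WithTop.coe_le_coe.mpr le_top
  rw [lift_extD, lift_extD, extDeriv_extDeriv hG h2]
  rfl

/-- The complex-valued coordinate `1`-form `dy_j` on `ℝ^d`. [cite: BottTu1982Forms, §I.1] -/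
def coordC (j : d) : EuclideanSpace ℝ d →L[ℝ] ℂ :=
  Complex.ofRealCLM.comp (EuclideanSpace.proj j)

omit [Fintype d] [DecidableEq d] in
/-- `dy_j(v) = v_j`. [cite: BottTu1982Forms, §I.1 (the coordinate `1`-forms `dx_i`)] -/
@[simp]
theorem coordC_apply (j : d) (v : EuclideanSpace ℝ d) : coordC j v = ((v j : ℝ) : ℂ) := rfl

omit [DecidableEq d] in
/-- `‖dy_j‖ ≤ 1`. [folklore] -/
private theorem norm_coordC_le (j : d) : ‖coordC j‖ ≤ 1 := by
  refine ContinuousLinearMap.opNorm_le_bound _ zero_le_one fun v => ?_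
  rw [coordC_apply, Complex.norm_real, one_mul]
  exact PiLp.norm_apply_le v j

/-- **The frequency covector `k♭ = Σ_j k_j dy_j`** of a Fourier mode `k ∈ ℤ^d` (the symbol of `d`:
`d(e_k c) = 2πi e_k · k♭ ∧ c`). [cite: Grafakos2014, Prop. 3.1.2 (10)] -/
def freqForm (k : d → ℤ) : EuclideanSpace ℝ d →L[ℝ] ℂ :=
  ∑ j, ((k j : ℝ) : ℂ) • coordC j

omit [DecidableEq d] in
/-- `k♭(v) = Σ_j k_j v_j`. [cite: Grafakos2014, Prop. 3.1.2 (10)] -/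
theorem freqForm_apply (k : d → ℤ) (v : EuclideanSpace ℝ d) :
    freqForm k v = ∑ j, ((k j : ℝ) : ℂ) * ((v j : ℝ) : ℂ) := by
  simp [freqForm]

omit [DecidableEq d] in
/-- `‖k♭‖ ≤ Σ_j |k_j| ≤ #d · (1 + |k|²)`. [cite: Grafakos2014, §3.3.3 (symbols of polynomial growth)] -/
theorem norm_freqForm_le (k : d → ℤ) : ‖freqForm k‖ ≤ Fintype.card d * (1 + freqNormSq k) := by
  calc ‖freqForm k‖ ≤ ∑ j, ‖((k j : ℝ) : ℂ) • coordC j‖ := norm_sum_le _ _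
    _ ≤ ∑ j : d, (1 + freqNormSq k) := by
        refine Finset.sum_le_sum fun j _ => ?_
        rw [norm_smul, Complex.norm_real, Real.norm_eq_abs]
        calc |(k j : ℝ)| * ‖coordC j‖ ≤ |(k j : ℝ)| * 1 :=
              mul_le_mul_of_nonneg_left (norm_coordC_le j) (abs_nonneg _)
          _ ≤ 1 + freqNormSq k := by rw [mul_one]; exact abs_apply_le_one_add_freqNormSq k j
    _ = Fintype.card d * (1 + freqNormSq k) := by
        rw [Finset.sum_const, Finset.card_univ, nsmul_eq_mul]

/-- A continuous linear map on `ℝ^d` is the sum of its values on the standard basis against the coordinates: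
`L = Σ_j dy_j ⊗ L(e_j)` (with complex coefficients `dy_j`). [folklore] -/
private theorem clm_eq_sum_coordC_smulRight {W : Type*} [NormedAddCommGroup W] [NormedSpace ℝ W] [NormedSpace ℂ W]
    [IsScalarTower ℝ ℂ W] (L : EuclideanSpace ℝ d →L[ℝ] W) :
    L = ∑ j, (coordC j).smulRight (L (EuclideanSpace.single j 1)) := by
  ext v
  have hv : v = ∑ j, (v j : ℝ) • EuclideanSpace.single j (1 : ℝ) := by
    conv_lhs => rw [← (EuclideanSpace.basisFun d ℝ).sum_repr v]
    simp [EuclideanSpace.basisFun_apply]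
  conv_lhs => rw [hv]
  rw [_root_.map_sum, _root_.sum_apply]
  refine Finset.sum_congr rfl fun j _ => ?_
  rw [ContinuousLinearMap.map_smul, ContinuousLinearMap.smulRight_apply, coordC_apply]
  exact (algebraMap_smul ℂ (v j) (L (EuclideanSpace.single j 1))).symm

/-- **`dG = Σ_j dy_j ∧ ∂_j G`** for a `C¹` form on the torus (the coordinate formula for the exterior derivative).
[cite: BottTu1982Forms, §I.1 (`dω = Σ ∂ω/∂x_i dx_i ∧ …`)] -/
theorem extD_eq_sum_wedgeOne {p : ℕ} {G : UnitAddTorus d → DForm d p} (hG : IsContDiff 1 G) (x : UnitAddTorus d) :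
    extD G x = ∑ j, wedgeOne (coordC j) (partialDeriv j G x) := by
  rw [extD, clm_eq_sum_coordC_smulRight (Torus.fderiv G x)]
  rw [← alternatizeUncurryFinCLM_apply, _root_.map_sum]
  refine Finset.sum_congr rfl fun j _ => ?_
  rw [alternatizeUncurryFinCLM_apply, partialDeriv_eq_fderiv_apply hG]
  rfl

omit [DecidableEq d] in
/-- `θ ∧ η` is additive in `θ` over finite sums. [folklore] -/
private theorem wedgeOne_sum_left {p : ℕ} {ι : Type*} (s : Finset ι) (θ : ι → EuclideanSpace ℝ d →L[ℝ] ℂ)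
    (η : DForm d p) : wedgeOne (∑ i ∈ s, θ i) η = ∑ i ∈ s, wedgeOne (θ i) η := by
  classical
  induction s using Finset.induction_on with
  | empty =>
      ext v
      simp [wedgeOne_apply]
  | insert a s ha ih => rw [Finset.sum_insert ha, Finset.sum_insert ha, wedgeOne_add_left, ih]

section Coeff

variable {V : Type*} [NormedAddCommGroup V] [NormedSpace ℂ V]

omit [DecidableEq d] in
/-- Fourier coefficients commute with continuous `ℂ`-linear maps: `𝓕(L ∘ G)(k) = L(𝓕G(k))` for continuous `G`.
[cite: Grafakos2014, Prop. 3.1.2 (linearity)] -/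
theorem mFourierCoeff_clm_comp {W : Type*} [NormedAddCommGroup W] [NormedSpace ℂ W] [CompleteSpace V]
    [CompleteSpace W] (L : V →L[ℂ] W) {G : UnitAddTorus d → V} (hG : Continuous G) (k : d → ℤ) :
    mFourierCoeff (fun x => L (G x)) k = L (mFourierCoeff G k) := by
  simp only [mFourierCoeff_eq_integral_volume]
  rw [← ContinuousLinearMap.integral_comp_comm L (integrable_mFourier_smul_of_continuous hG k)]
  congr 1
  funext x
  rw [map_smul]

omit [DecidableEq d] in
/-- Fourier coefficients of a sum of continuous functions. [cite: Grafakos2014, Prop. 3.1.2 (linearity)] -/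
theorem mFourierCoeff_add_of_continuous [CompleteSpace V] {f g : UnitAddTorus d → V} (hf : Continuous f)
    (hg : Continuous g) (k : d → ℤ) :
    mFourierCoeff (fun x => f x + g x) k = mFourierCoeff f k + mFourierCoeff g k := by
  simp only [mFourierCoeff_eq_integral_volume, smul_add]
  exact integral_add (integrable_mFourier_smul_of_continuous hf k) (integrable_mFourier_smul_of_continuous hg k)

end Coeff

/-- **Fourier coefficients of the exterior derivative**: `𝓕(dG)(k) = 2πi · k♭ ∧ 𝓕G(k)` for a smooth `p`-form
`G` on `T^d` — the tree's `𝓕(∂_j G)(k) = 2πi k_j 𝓕G(k)` (Grafakos 2014, Prop. 3.1.2 (10)) summed against `dy_j ∧ ·`.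
[cite: Grafakos2014, Prop. 3.1.2 (10)] -/
theorem mFourierCoeff_extD {p : ℕ} {G : UnitAddTorus d → DForm d p} (hG : IsSmooth G) (k : d → ℤ) :
    mFourierCoeff (extD G) k = (2 * Real.pi * I : ℂ) • wedgeOne (freqForm k) (mFourierCoeff G k) := by
  have h1 : extD G = fun x => ∑ j, (wedgeOneL (coordC j)) (partialDeriv j G x) := by
    funext x
    rw [extD_eq_sum_wedgeOne (hG.isContDiff (by simp)) x]
    simp only [wedgeOneL_apply]
  have hcont : ∀ j, Continuous fun x => (wedgeOneL (coordC j)) (partialDeriv j G x) := fun j =>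
    (wedgeOneL (coordC j)).continuous.comp (hG.partialDeriv j).continuous
  have hint : ∀ j, Integrable (fun x => (wedgeOneL (coordC j)) (partialDeriv j G x)) volume := fun j =>
    (hcont j).integrable_unitAddTorus
  have hsum : mFourierCoeff (fun x => ∑ j, (wedgeOneL (coordC j)) (partialDeriv j G x)) k =
      ∑ j, mFourierCoeff (fun x => (wedgeOneL (coordC j)) (partialDeriv j G x)) k :=
    mFourierCoeff_finset_sum Finset.univ (fun j _ => hint j) k
  rw [h1, hsum]
  have hterm : ∀ j, mFourierCoeff (fun x => (wedgeOneL (coordC j)) (partialDeriv j G x)) k =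
      (2 * Real.pi * I * (k j) : ℂ) • wedgeOne (coordC j) (mFourierCoeff G k) := fun j => by
    rw [mFourierCoeff_clm_comp (wedgeOneL (coordC j)) (hG.partialDeriv j).continuous, mFourierCoeff_partialDeriv hG,
      wedgeOneL_apply, wedgeOne_smul]
  simp_rw [hterm]
  rw [freqForm, wedgeOne_sum_left, Finset.smul_sum]
  refine Finset.sum_congr rfl fun j _ => ?_
  rw [wedgeOne_smul_left, smul_smul]
  congr 1

end ExtD

/-! ## §2 Coefficient operators of a weight family on `T^{ι₁} × T^{ι₂}` -/

section Coefficients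

variable {ι₁ ι₂ : Type*} [Fintype ι₁] [Fintype ι₂] [DecidableEq ι₁] [DecidableEq ι₂]
variable {V : Type*} [NormedAddCommGroup V] [NormedSpace ℂ V]

/-- The AVERAGED part of a coefficient family on `ℤ^{ι₁ ⊕ ι₂}`: keep the modes with `k|ι₁ = 0`.
[cite: Freitag1990, Ch. III §2, p. 145 («the coefficients do not depend on `x`»)] -/
def avgCoeff (c : (ι₁ ⊕ ι₂ → ℤ) → V) (k : ι₁ ⊕ ι₂ → ℤ) : V :=
  if k ∘ Sum.inl = 0 then c k else 0

/-- The OSCILLATING part of a coefficient family: the modes with `k|ι₁ ≠ 0`. [cite: Freitag1990, Ch. III §2, p. 145] -/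
def oscCoeff (c : (ι₁ ⊕ ι₂ → ℤ) → V) (k : ι₁ ⊕ ι₂ → ℤ) : V :=
  if k ∘ Sum.inl = 0 then 0 else c k

omit [Fintype ι₂] [DecidableEq ι₁] [DecidableEq ι₂] [NormedSpace ℂ V] in
/-- `c = avg c + osc c`. [cite: Freitag1990, Ch. III §2, p. 145 (the `x`-independent part of a form)] -/
theorem avgCoeff_add_oscCoeff (c : (ι₁ ⊕ ι₂ → ℤ) → V) (k : ι₁ ⊕ ι₂ → ℤ) :
    avgCoeff c k + oscCoeff c k = c k := by
  unfold avgCoeff oscCoeff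
  split_ifs <;> simp

omit [Fintype ι₂] [DecidableEq ι₁] [DecidableEq ι₂] [NormedSpace ℂ V] in
/-- `‖avg c k‖ ≤ ‖c k‖`. [folklore] -/
private theorem norm_avgCoeff_le (c : (ι₁ ⊕ ι₂ → ℤ) → V) (k : ι₁ ⊕ ι₂ → ℤ) : ‖avgCoeff c k‖ ≤ ‖c k‖ := by
  unfold avgCoeff
  split_ifs <;> simp

omit [Fintype ι₂] [DecidableEq ι₁] [DecidableEq ι₂] [NormedSpace ℂ V] in
/-- `‖osc c k‖ ≤ ‖c k‖`. [folklore] -/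
private theorem norm_oscCoeff_le (c : (ι₁ ⊕ ι₂ → ℤ) → V) (k : ι₁ ⊕ ι₂ → ℤ) : ‖oscCoeff c k‖ ≤ ‖c k‖ := by
  unfold oscCoeff
  split_ifs <;> simp

omit [DecidableEq ι₁] [DecidableEq ι₂] [NormedSpace ℂ V] in
/-- Rapid decay passes to the averaged part. [cite: Grafakos2014, Thm. 3.3.9] -/
theorem RapidDecay.avgCoeff {c : (ι₁ ⊕ ι₂ → ℤ) → V} (hc : RapidDecay c) : RapidDecay (avgCoeff c) :=
  hc.of_norm_le_mul (C := 1) fun k => by rw [one_mul]; exact norm_avgCoeff_le c k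

omit [DecidableEq ι₁] [DecidableEq ι₂] [NormedSpace ℂ V] in
/-- Rapid decay passes to the oscillating part. [cite: Grafakos2014, Thm. 3.3.9] -/
theorem RapidDecay.oscCoeff {c : (ι₁ ⊕ ι₂ → ℤ) → V} (hc : RapidDecay c) : RapidDecay (oscCoeff c) :=
  hc.of_norm_le_mul (C := 1) fun k => by rw [one_mul]; exact norm_oscCoeff_le c k

/-- **The symbol of `d`** on coefficient families: `(dCoeff c)(k) = 2πi · k♭ ∧ c k`. [cite: Grafakos2014, Prop. 3.1.2 (10)] -/
def dCoeff {p : ℕ} (c : (ι₁ ⊕ ι₂ → ℤ) → DForm (ι₁ ⊕ ι₂) p) (k : ι₁ ⊕ ι₂ → ℤ) : DForm (ι₁ ⊕ ι₂) (p + 1) :=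
  (2 * Real.pi * I : ℂ) • wedgeOne (freqForm k) (c k)

/-- **The symbol of the homotopy** for a weight family `W : ℤ^{ι₁} → ℝ^{ι₁ ⊕ ι₂}`: on the modes `k|ι₁ ≠ 0`,
`(homCoeff W c)(k) = (2πi)⁻¹ · W_{k|ι₁} ⌟ c k`; zero on the modes `k|ι₁ = 0`. [cite: BottTu1982Forms, §I.4 (homotopy operators)] -/
def homCoeff {p : ℕ} (W : (ι₁ → ℤ) → EuclideanSpace ℝ (ι₁ ⊕ ι₂)) (c : (ι₁ ⊕ ι₂ → ℤ) → DForm (ι₁ ⊕ ι₂) (p + 1))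
    (k : ι₁ ⊕ ι₂ → ℤ) : DForm (ι₁ ⊕ ι₂) p :=
  if k ∘ Sum.inl = 0 then 0 else (2 * Real.pi * I : ℂ)⁻¹ • (c k).curryLeft (W (k ∘ Sum.inl))

omit [DecidableEq ι₁] [DecidableEq ι₂] in
/-- `freqNormSq (k|ι₁) ≤ freqNormSq k`. [folklore] -/
private theorem freqNormSq_comp_inl_le (k : ι₁ ⊕ ι₂ → ℤ) : freqNormSq (k ∘ Sum.inl) ≤ freqNormSq k := by
  unfold freqNormSq
  rw [Fintype.sum_sum_type]
  simp only [Function.comp_apply, le_add_iff_nonneg_right]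
  exact Finset.sum_nonneg fun i _ => sq_nonneg _

/-- A weight family of POLYNOMIAL GROWTH: `‖W_{k₁}‖ ≤ C (1 + |k₁|²)^s` (a Fourier multiplier symbol of polynomial
growth). [cite: Grafakos2014, §3.3.3] -/
def PolyGrowth (W : (ι₁ → ℤ) → EuclideanSpace ℝ (ι₁ ⊕ ι₂)) : Prop :=
  ∃ (C : ℝ) (s : ℕ), ∀ k₁, ‖W k₁‖ ≤ C * (1 + freqNormSq k₁) ^ s

/-- A weight family is NORMALISED if `k♭(W_{k|ι₁}) = 1` on every mode with `k|ι₁ ≠ 0` (so that `W_k ⌟` inverts the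
symbol `k♭ ∧` of `d` on the oscillating modes). [cite: BottTu1982Forms, §I.4 (homotopy operators)] -/
def IsNormalised (W : (ι₁ → ℤ) → EuclideanSpace ℝ (ι₁ ⊕ ι₂)) : Prop :=
  ∀ k : ι₁ ⊕ ι₂ → ℤ, k ∘ Sum.inl ≠ 0 → freqForm k (W (k ∘ Sum.inl)) = 1

omit [DecidableEq ι₁] [DecidableEq ι₂] [NormedSpace ℂ V] in
/-- Domination across value spaces: if `‖c' k‖ ≤ C (1 + |k|²)^s ‖c k‖` then rapid decay of `c` implies rapid
decay of `c'` (the tree's `RapidDecay.of_norm_le_mul_pow`, which is stated for a common value space). [folklore] -/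
private theorem RapidDecay.of_norm_le_mul_pow' {W' : Type*} [NormedAddCommGroup W'] {c : (ι₁ ⊕ ι₂ → ℤ) → V}
    {c' : (ι₁ ⊕ ι₂ → ℤ) → W'} (hc : RapidDecay c) {C : ℝ} {s : ℕ}
    (h : ∀ k, ‖c' k‖ ≤ C * (1 + freqNormSq k) ^ s * ‖c k‖) : RapidDecay c' := by
  intro m
  have hC : ∀ k, 0 ≤ C * (1 + freqNormSq k) ^ s * ‖c k‖ := fun k => (norm_nonneg _).trans (h k)
  refine Summable.of_nonneg_of_le
    (fun k => mul_nonneg (one_add_freqNormSq_pow_nonneg k m) (norm_nonneg _))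
    (fun k => mul_le_mul_of_nonneg_left (h k) (one_add_freqNormSq_pow_nonneg k m)) ?_
  have := (hc (m + s)).mul_left |C|
  refine Summable.of_nonneg_of_le
    (fun k => mul_nonneg (one_add_freqNormSq_pow_nonneg k m) (hC k)) (fun k => ?_) this
  calc (1 + freqNormSq k) ^ m * (C * (1 + freqNormSq k) ^ s * ‖c k‖)
      = C * ((1 + freqNormSq k) ^ (m + s) * ‖c k‖) := by rw [pow_add]; ring
    _ ≤ |C| * ((1 + freqNormSq k) ^ (m + s) * ‖c k‖) :=
        mul_le_mul_of_nonneg_right (le_abs_self C)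
          (mul_nonneg (one_add_freqNormSq_pow_nonneg k _) (norm_nonneg _))

/-- `‖2πi‖ = 2π`. [folklore] -/
private theorem norm_two_pi_I : ‖(2 * Real.pi * I : ℂ)‖ = 2 * Real.pi := by
  simp [abs_of_pos Real.pi_pos]

omit [DecidableEq ι₁] [DecidableEq ι₂] in
/-- Rapid decay is preserved by `dCoeff` (a symbol of linear growth). [cite: Grafakos2014, Prop. 3.1.2 (10) and §3.3.3] -/
theorem RapidDecay.dCoeff {p : ℕ} {c : (ι₁ ⊕ ι₂ → ℤ) → DForm (ι₁ ⊕ ι₂) p} (hc : RapidDecay c) :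
    RapidDecay (dCoeff c) := by
  refine hc.of_norm_le_mul_pow' (C := 2 * Real.pi * ((p + 1) * Fintype.card (ι₁ ⊕ ι₂))) (s := 1) fun k => ?_
  rw [Torus.dCoeff, norm_smul, norm_two_pi_I, pow_one]
  have h1 := norm_wedgeOne_le (freqForm k) (c k)
  have h2 := norm_freqForm_le k
  have hp : (0 : ℝ) ≤ p + 1 := by positivity
  have h3 : ((p : ℝ) + 1) * ‖freqForm k‖ * ‖c k‖ ≤
      ((p : ℝ) + 1) * (Fintype.card (ι₁ ⊕ ι₂) * (1 + freqNormSq k)) * ‖c k‖ :=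
    mul_le_mul_of_nonneg_right (mul_le_mul_of_nonneg_left h2 hp) (norm_nonneg _)
  have h4 := mul_le_mul_of_nonneg_left (h1.trans h3) (le_of_lt Real.two_pi_pos)
  calc 2 * Real.pi * ‖wedgeOne (freqForm k) (c k)‖
      ≤ 2 * Real.pi * (((p : ℝ) + 1) * (Fintype.card (ι₁ ⊕ ι₂) * (1 + freqNormSq k)) * ‖c k‖) := h4
    _ = 2 * Real.pi * ((p + 1) * Fintype.card (ι₁ ⊕ ι₂)) * (1 + freqNormSq k) * ‖c k‖ := by ring

omit [DecidableEq ι₁] [DecidableEq ι₂] in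
/-- Rapid decay is preserved by `homCoeff W` for a weight family of polynomial growth. [cite: Grafakos2014, §3.3.3 (multipliers of polynomial growth preserve rapid decay)] -/
theorem RapidDecay.homCoeff {p : ℕ} {W : (ι₁ → ℤ) → EuclideanSpace ℝ (ι₁ ⊕ ι₂)} (hW : PolyGrowth W)
    {c : (ι₁ ⊕ ι₂ → ℤ) → DForm (ι₁ ⊕ ι₂) (p + 1)} (hc : RapidDecay c) : RapidDecay (homCoeff W c) := by
  obtain ⟨C, s, hCW⟩ := hW
  have hC0 : 0 ≤ C := by
    have h0 := (norm_nonneg _).trans (hCW 0)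
    have h1 : (0 : ℝ) < (1 + freqNormSq (0 : ι₁ → ℤ)) ^ s :=
      pow_pos (zero_lt_one.trans_le (one_le_one_add_freqNormSq _)) s
    nlinarith
  set A : ℝ := ‖(2 * Real.pi * I : ℂ)⁻¹‖ with hA
  have hA0 : 0 ≤ A := norm_nonneg _
  refine hc.of_norm_le_mul_pow' (C := A * C) (s := s) fun k => ?_
  have hks : (1 + freqNormSq (k ∘ Sum.inl)) ^ s ≤ (1 + freqNormSq k) ^ s :=
    pow_le_pow_left₀ (zero_le_one.trans (one_le_one_add_freqNormSq _))
      (by linarith [freqNormSq_comp_inl_le k]) s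
  unfold Torus.homCoeff
  split_ifs with hk
  · rw [norm_zero]
    exact mul_nonneg (mul_nonneg (mul_nonneg hA0 hC0) (one_add_freqNormSq_pow_nonneg k s)) (norm_nonneg _)
  · rw [norm_smul, ← hA]
    have h1 : ‖(c k).curryLeft (W (k ∘ Sum.inl))‖ ≤ ‖c k‖ * ‖W (k ∘ Sum.inl)‖ := by
      have := ((c k).curryLeft).le_opNorm (W (k ∘ Sum.inl))
      rwa [norm_curryLeft] at this
    have h2 : ‖W (k ∘ Sum.inl)‖ ≤ C * (1 + freqNormSq k) ^ s :=
      (hCW _).trans (mul_le_mul_of_nonneg_left hks hC0)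
    have h3 : ‖(c k).curryLeft (W (k ∘ Sum.inl))‖ ≤ ‖c k‖ * (C * (1 + freqNormSq k) ^ s) :=
      h1.trans (mul_le_mul_of_nonneg_left h2 (norm_nonneg _))
    calc A * ‖(c k).curryLeft (W (k ∘ Sum.inl))‖
        ≤ A * (‖c k‖ * (C * (1 + freqNormSq k) ^ s)) := mul_le_mul_of_nonneg_left h3 hA0
      _ = A * C * (1 + freqNormSq k) ^ s * ‖c k‖ := by ring

/-- `2πi ≠ 0`. [folklore] -/
private theorem two_pi_I_ne_zero' : (2 * Real.pi * I : ℂ) ≠ 0 := by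
  simp [Real.pi_ne_zero, I_ne_zero]

omit [DecidableEq ι₁] [DecidableEq ι₂] in
/-- **The coefficient identity** (Cartan's `w ⌟ (θ ∧ η) + θ ∧ (w ⌟ η) = θ(w) η` mode by mode): for a normalised
weight family, `dCoeff (homCoeff W c) + homCoeff W (dCoeff c) = oscCoeff c`. [cite: Warner1983, 2.11] -/
theorem dCoeff_homCoeff_add_homCoeff_dCoeff {p : ℕ} {W : (ι₁ → ℤ) → EuclideanSpace ℝ (ι₁ ⊕ ι₂)}
    (hW : IsNormalised W) (c : (ι₁ ⊕ ι₂ → ℤ) → DForm (ι₁ ⊕ ι₂) (p + 1)) (k : ι₁ ⊕ ι₂ → ℤ) :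
    dCoeff (homCoeff W c) k + homCoeff W (dCoeff c) k = oscCoeff c k := by
  unfold dCoeff homCoeff oscCoeff
  by_cases hk : k ∘ Sum.inl = 0
  · simp [hk]
  · simp only [hk, if_false]
    rw [wedgeOne_smul, smul_smul, mul_inv_cancel₀ two_pi_I_ne_zero', one_smul, curryLeft_smul', smul_smul,
      inv_mul_cancel₀ two_pi_I_ne_zero', one_smul, curryLeft_wedgeOne, hW k hk, one_smul]
    abel

omit [DecidableEq ι₁] [DecidableEq ι₂] in
/-- The coefficient identity in degree `0`: `homCoeff W (dCoeff c) = oscCoeff c` (`w ⌟ (θ ∧ η) = θ(w) η` for a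
`0`-form `η`). [cite: Warner1983, 2.11] -/
theorem homCoeff_dCoeff_of_degree_zero {W : (ι₁ → ℤ) → EuclideanSpace ℝ (ι₁ ⊕ ι₂)} (hW : IsNormalised W)
    (c : (ι₁ ⊕ ι₂ → ℤ) → DForm (ι₁ ⊕ ι₂) 0) (k : ι₁ ⊕ ι₂ → ℤ) :
    homCoeff W (dCoeff c) k = oscCoeff c k := by
  unfold dCoeff homCoeff oscCoeff
  by_cases hk : k ∘ Sum.inl = 0
  · simp [hk]
  · simp only [hk, if_false]
    rw [curryLeft_smul', smul_smul, inv_mul_cancel₀ two_pi_I_ne_zero', one_smul, curryLeft_wedgeOne_zero,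
      hW k hk, one_smul]

omit [DecidableEq ι₁] [DecidableEq ι₂] in
/-- `dCoeff` commutes with the averaging projection. [cite: Freitag1990, Ch. III §2, p. 145] -/
theorem dCoeff_avgCoeff {p : ℕ} (c : (ι₁ ⊕ ι₂ → ℤ) → DForm (ι₁ ⊕ ι₂) p) (k : ι₁ ⊕ ι₂ → ℤ) :
    dCoeff (avgCoeff c) k = avgCoeff (dCoeff c) k := by
  unfold dCoeff avgCoeff
  split_ifs <;> simp

end Coefficients

/-! ## §3 The fibre average and the homotopy operator; the homotopy formula -/

section Operators

variable {ι₁ ι₂ : Type*} [Fintype ι₁] [Fintype ι₂] [DecidableEq ι₁] [DecidableEq ι₂]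
variable {V : Type*} [NormedAddCommGroup V] [NormedSpace ℂ V] [CompleteSpace V]

/-- **The fibre average** of `G : T^{ι₁ ⊕ ι₂} → V` along `T^{ι₁}`: the Fourier synthesis of the modes with
`k|ι₁ = 0` (for smooth `G` this is `(x₁, x₂) ↦ ∫_{T^{ι₁}} G(t, x₂) dt`, `fibreAvg_apply`).
[cite: Freitag1990, Ch. III §2, p. 145 («the coefficients do not depend on `x`»)] -/
def fibreAvg (G : UnitAddTorus (ι₁ ⊕ ι₂) → V) : UnitAddTorus (ι₁ ⊕ ι₂) → V :=
  fourierSynth (avgCoeff (mFourierCoeff G))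

/-- **The homotopy operator** of the weight family `W` on `(p+1)`-forms: the Fourier synthesis of
`(2πi)⁻¹ W_{k|ι₁} ⌟ 𝓕G(k)` over the modes `k|ι₁ ≠ 0`. [cite: BottTu1982Forms, §I.4] -/
def fibreHom {p : ℕ} (W : (ι₁ → ℤ) → EuclideanSpace ℝ (ι₁ ⊕ ι₂)) (G : UnitAddTorus (ι₁ ⊕ ι₂) → DForm (ι₁ ⊕ ι₂) (p + 1)) :
    UnitAddTorus (ι₁ ⊕ ι₂) → DForm (ι₁ ⊕ ι₂) p :=
  fourierSynth (homCoeff W (mFourierCoeff G))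

/-- The fibre average of a smooth function is smooth. [cite: Grafakos2014, §3.3.3 (absolutely convergent Fourier series are smooth for rapidly decaying coefficients)] -/
theorem IsSmooth.fibreAvg {G : UnitAddTorus (ι₁ ⊕ ι₂) → V} (hG : IsSmooth G) : IsSmooth (fibreAvg G) :=
  hG.rapidDecay_mFourierCoeff.avgCoeff.isSmooth_fourierSynth

/-- The Fourier coefficients of the fibre average. [cite: Grafakos2014, Prop. 3.2.5] -/
theorem mFourierCoeff_fibreAvg {G : UnitAddTorus (ι₁ ⊕ ι₂) → V} (hG : IsSmooth G) (k : ι₁ ⊕ ι₂ → ℤ) :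
    mFourierCoeff (fibreAvg G) k = avgCoeff (mFourierCoeff G) k :=
  hG.rapidDecay_mFourierCoeff.avgCoeff.mFourierCoeff_fourierSynth k

/-- The homotopy operator of a polynomially bounded weight family takes smooth forms to smooth forms. [cite: Grafakos2014, §3.3.3] -/
theorem IsSmooth.fibreHom {p : ℕ} {W : (ι₁ → ℤ) → EuclideanSpace ℝ (ι₁ ⊕ ι₂)} (hW : PolyGrowth W)
    {G : UnitAddTorus (ι₁ ⊕ ι₂) → DForm (ι₁ ⊕ ι₂) (p + 1)} (hG : IsSmooth G) : IsSmooth (fibreHom W G) :=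
  (hG.rapidDecay_mFourierCoeff.homCoeff hW).isSmooth_fourierSynth

/-- The Fourier coefficients of `fibreHom W G`. [cite: Grafakos2014, Prop. 3.2.5] -/
theorem mFourierCoeff_fibreHom {p : ℕ} {W : (ι₁ → ℤ) → EuclideanSpace ℝ (ι₁ ⊕ ι₂)} (hW : PolyGrowth W)
    {G : UnitAddTorus (ι₁ ⊕ ι₂) → DForm (ι₁ ⊕ ι₂) (p + 1)} (hG : IsSmooth G) (k : ι₁ ⊕ ι₂ → ℤ) :
    mFourierCoeff (fibreHom W G) k = homCoeff W (mFourierCoeff G) k :=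
  (hG.rapidDecay_mFourierCoeff.homCoeff hW).mFourierCoeff_fourierSynth k

/-- The Fourier coefficients of `dG` as a family: `𝓕(dG) = dCoeff (𝓕 G)`. [cite: Grafakos2014, Prop. 3.1.2 (10)] -/
theorem mFourierCoeff_extD_eq_dCoeff {p : ℕ} {G : UnitAddTorus (ι₁ ⊕ ι₂) → DForm (ι₁ ⊕ ι₂) p} (hG : IsSmooth G) :
    mFourierCoeff (extD G) = dCoeff (mFourierCoeff G) := by
  funext k
  exact mFourierCoeff_extD hG k

omit [DecidableEq ι₁] [DecidableEq ι₂] in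
/-- `IsSmooth` is closed under pointwise addition. [folklore] -/
private theorem IsSmooth.add' {W' : Type*} [NormedAddCommGroup W'] [NormedSpace ℝ W'] {f g : UnitAddTorus (ι₁ ⊕ ι₂) → W'}
    (hf : IsSmooth f) (hg : IsSmooth g) : IsSmooth (fun x => f x + g x) :=
  ContDiff.add hf hg

omit [DecidableEq ι₁] [DecidableEq ι₂] in
/-- `IsSmooth` is closed under pointwise subtraction. [folklore] -/
private theorem IsSmooth.sub' {W' : Type*} [NormedAddCommGroup W'] [NormedSpace ℝ W'] {f g : UnitAddTorus (ι₁ ⊕ ι₂) → W'}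
    (hf : IsSmooth f) (hg : IsSmooth g) : IsSmooth (fun x => f x - g x) :=
  ContDiff.sub hf hg

/-- **THE HOMOTOPY FORMULA `d(K G) + K(dG) = G − A G`** for a smooth `(p+1)`-form `G` on `T^{ι₁} × T^{ι₂}`, the fibre
average `A = fibreAvg` and the homotopy `K = fibreHom W` of a normalised weight family of polynomial growth:
fibrewise averaging is chain-homotopic to the identity.  Proof: both sides are smooth and have the same
Fourier coefficients (`dCoeff_homCoeff_add_homCoeff_dCoeff`).
[cite: Freitag1990, Ch. III §2, Prop. 2.1 (proof), pp. 144–145] [cite: BottTu1982Forms, §I.4] -/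
theorem extD_fibreHom_add_fibreHom_extD {p : ℕ} {W : (ι₁ → ℤ) → EuclideanSpace ℝ (ι₁ ⊕ ι₂)}
    (hW : IsNormalised W) (hW' : PolyGrowth W) {G : UnitAddTorus (ι₁ ⊕ ι₂) → DForm (ι₁ ⊕ ι₂) (p + 1)}
    (hG : IsSmooth G) :
    (fun x => extD (fibreHom W G) x + fibreHom W (extD G) x) = fun x => G x - fibreAvg G x := by
  have hK : IsSmooth (fibreHom W G) := hG.fibreHom hW'
  have hdK : IsSmooth (extD (fibreHom W G)) := hK.extD
  have hKd : IsSmooth (fibreHom W (extD G)) := hG.extD.fibreHom hW'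
  have hA : IsSmooth (fibreAvg G) := hG.fibreAvg
  refine IsSmooth.ext_mFourierCoeff (hdK.add' hKd) (hG.sub' hA) fun k => ?_
  rw [mFourierCoeff_add_of_continuous hdK.continuous hKd.continuous,
    show (fun x => G x - fibreAvg G x) = G - fibreAvg G from rfl,
    mFourierCoeff_sub hG.integrable hA.integrable,
    mFourierCoeff_extD hK, mFourierCoeff_fibreHom hW' hG, mFourierCoeff_fibreHom hW' hG.extD,
    mFourierCoeff_extD_eq_dCoeff hG, mFourierCoeff_fibreAvg hG]
  have := dCoeff_homCoeff_add_homCoeff_dCoeff hW (mFourierCoeff G) k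
  rw [dCoeff] at this
  rw [this, eq_sub_iff_add_eq', avgCoeff_add_oscCoeff]

/-- The homotopy formula in degree `0`: `K(dG) = G − A G` for a smooth function `G` (a `0`-form has no `K G`).
[cite: Freitag1990, Ch. III §2, Prop. 2.1 (proof), pp. 144–145] -/
theorem fibreHom_extD_of_degree_zero {W : (ι₁ → ℤ) → EuclideanSpace ℝ (ι₁ ⊕ ι₂)}
    (hW : IsNormalised W) (hW' : PolyGrowth W) {G : UnitAddTorus (ι₁ ⊕ ι₂) → DForm (ι₁ ⊕ ι₂) 0}
    (hG : IsSmooth G) :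
    fibreHom W (extD G) = fun x => G x - fibreAvg G x := by
  have hKd : IsSmooth (fibreHom W (extD G)) := hG.extD.fibreHom hW'
  have hA : IsSmooth (fibreAvg G) := hG.fibreAvg
  refine IsSmooth.ext_mFourierCoeff hKd (hG.sub' hA) fun k => ?_
  rw [show (fun x => G x - fibreAvg G x) = G - fibreAvg G from rfl,
    mFourierCoeff_sub hG.integrable hA.integrable, mFourierCoeff_fibreHom hW' hG.extD,
    mFourierCoeff_extD_eq_dCoeff hG, mFourierCoeff_fibreAvg hG, homCoeff_dCoeff_of_degree_zero hW,
    eq_sub_iff_add_eq', avgCoeff_add_oscCoeff]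

/-- **The fibre average is a chain map**: `d(A G) = A(dG)`. [cite: Freitag1990, Ch. III §2, Prop. 2.1 (proof), p. 145] -/
theorem extD_fibreAvg {p : ℕ} {G : UnitAddTorus (ι₁ ⊕ ι₂) → DForm (ι₁ ⊕ ι₂) p} (hG : IsSmooth G) :
    extD (fibreAvg G) = fibreAvg (extD G) := by
  have hA : IsSmooth (fibreAvg G) := hG.fibreAvg
  refine IsSmooth.ext_mFourierCoeff hA.extD hG.extD.fibreAvg fun k => ?_
  rw [mFourierCoeff_extD hA, mFourierCoeff_fibreAvg hG, mFourierCoeff_fibreAvg hG.extD,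
    mFourierCoeff_extD_eq_dCoeff hG, ← dCoeff_avgCoeff, dCoeff]

/-- **A closed form is its fibre average plus an exact form**: if `dG = 0` then `G = A G + d(K G)`.
[cite: Freitag1990, Ch. III §2, Prop. 2.1 (proof), pp. 144–145] -/
theorem eq_fibreAvg_add_extD_fibreHom {p : ℕ} {W : (ι₁ → ℤ) → EuclideanSpace ℝ (ι₁ ⊕ ι₂)}
    (hW : IsNormalised W) (hW' : PolyGrowth W) {G : UnitAddTorus (ι₁ ⊕ ι₂) → DForm (ι₁ ⊕ ι₂) (p + 1)}
    (hG : IsSmooth G) (hdG : extD G = 0) :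
    G = fun x => fibreAvg G x + extD (fibreHom W G) x := by
  have h := extD_fibreHom_add_fibreHom_extD hW hW' hG
  have hK0 : fibreHom W (extD G) = 0 := by
    rw [hdG]
    unfold fibreHom
    have : mFourierCoeff (0 : UnitAddTorus (ι₁ ⊕ ι₂) → DForm (ι₁ ⊕ ι₂) (p + 1 + 1)) = 0 := by
      funext k
      rw [mFourierCoeff_eq_integral_volume]
      simp
    rw [this]
    have h0 : homCoeff W (0 : (ι₁ ⊕ ι₂ → ℤ) → DForm (ι₁ ⊕ ι₂) (p + 1 + 1)) = 0 := by
      funext k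
      unfold homCoeff
      split_ifs <;> simp
    rw [h0]
    funext x
    simp [fourierSynth]
  funext x
  have hx := congrFun h x
  simp only [hK0, Pi.zero_apply, add_zero] at hx
  rw [hx]
  abel

/-- The fibre average of the fibre average: `A(A G) = A G`. [cite: Freitag1990, Ch. III §2, p. 145] -/
theorem fibreAvg_fibreAvg {G : UnitAddTorus (ι₁ ⊕ ι₂) → V} (hG : IsSmooth G) :
    fibreAvg (fibreAvg G) = fibreAvg G := by
  refine IsSmooth.ext_mFourierCoeff hG.fibreAvg.fibreAvg hG.fibreAvg fun k => ?_
  rw [mFourierCoeff_fibreAvg hG.fibreAvg]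
  unfold avgCoeff
  split_ifs with h
  · rfl
  · rw [mFourierCoeff_fibreAvg hG]
    unfold avgCoeff
    rw [if_neg h]

end Operators


/-! ## §4 The fibre structure over `ι₁ ⊕ ι₂`: partial coefficients, Fubini, partial synthesis, locality -/

section Fibre

variable {ι₁ ι₂ : Type*} [Fintype ι₁] [Fintype ι₂] [DecidableEq ι₁] [DecidableEq ι₂]
variable {V : Type*} [NormedAddCommGroup V] [NormedSpace ℂ V] [CompleteSpace V]

omit [DecidableEq ι₁] [DecidableEq ι₂] in
/-- The characters factor over `ι₁ ⊕ ι₂`: `e_{(k₁,k₂)}(x₁, x₂) = e_{k₁}(x₁) e_{k₂}(x₂)`. [cite: Grafakos2014, §3.1.1] -/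
theorem mFourier_sumElim (k₁ : ι₁ → ℤ) (k₂ : ι₂ → ℤ) (x₁ : UnitAddTorus ι₁) (x₂ : UnitAddTorus ι₂) :
    mFourier (Sum.elim k₁ k₂) (Sum.elim x₁ x₂ : UnitAddTorus (ι₁ ⊕ ι₂)) = mFourier k₁ x₁ * mFourier k₂ x₂ := by
  simp only [mFourier, ContinuousMap.coe_mk, Fintype.prod_sum_type, Sum.elim_inl, Sum.elim_inr]

omit [Fintype ι₁] [Fintype ι₂] [DecidableEq ι₁] [DecidableEq ι₂] in
/-- `-(k₁, k₂) = (-k₁, -k₂)`. [folklore] -/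
private theorem neg_sumElim (k₁ : ι₁ → ℤ) (k₂ : ι₂ → ℤ) : -(Sum.elim k₁ k₂) = Sum.elim (-k₁) (-k₂) := by
  funext i
  cases i <;> rfl

omit [Fintype ι₁] [Fintype ι₂] [DecidableEq ι₁] [DecidableEq ι₂] in
/-- `(k₁, k₂)|ι₁ = k₁`. [folklore] -/
private theorem sumElim_comp_inl' {γ : Type*} (a : ι₁ → γ) (b : ι₂ → γ) : Sum.elim a b ∘ Sum.inl = a := by
  funext i
  rfl

omit [Fintype ι₁] [Fintype ι₂] [DecidableEq ι₁] [DecidableEq ι₂] in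
/-- `(k₁, k₂)|ι₂ = k₂`. [folklore] -/
private theorem sumElim_comp_inr' {γ : Type*} (a : ι₁ → γ) (b : ι₂ → γ) : Sum.elim a b ∘ Sum.inr = b := by
  funext i
  rfl

/-- **Partial Fourier coefficients along the fibre**: `fibreCoeff G k₁ x₂ = ∫_{T^{ι₁}} e_{−k₁}(t) G(t, x₂) dt`.
[cite: Grafakos2014, §3.1.1 (Fourier coefficients)] -/
def fibreCoeff (G : UnitAddTorus (ι₁ ⊕ ι₂) → V) (k₁ : ι₁ → ℤ) (x₂ : UnitAddTorus ι₂) : V :=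
  ∫ t : UnitAddTorus ι₁, mFourier (-k₁) t • G (Sum.elim t x₂)

omit [Fintype ι₁] [Fintype ι₂] [DecidableEq ι₁] [DecidableEq ι₂] in
/-- `(t, x₂) ↦ (t, x₂)` as a point of `T^{ι₁ ⊕ ι₂}` is continuous. [folklore] -/
private theorem continuous_sumElim :
    Continuous fun p : UnitAddTorus ι₁ × UnitAddTorus ι₂ => (Sum.elim p.1 p.2 : UnitAddTorus (ι₁ ⊕ ι₂)) := by
  refine continuous_pi fun i => ?_
  cases i with
  | inl a => exact (continuous_apply a).comp continuous_fst
  | inr b => exact (continuous_apply b).comp continuous_snd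

omit [DecidableEq ι₁] [DecidableEq ι₂] [CompleteSpace V] in
/-- The partial coefficients of a continuous function depend continuously on the base point
(Mathlib's `continuous_parametric_integral_of_continuous` on the compact fibre). [cite: Grafakos2014, §3.1.1 (partial Fourier coefficients)] -/
theorem continuous_fibreCoeff {G : UnitAddTorus (ι₁ ⊕ ι₂) → V} (hG : Continuous G) (k₁ : ι₁ → ℤ) :
    Continuous (fibreCoeff G k₁) := by
  have hF : Continuous (Function.uncurry fun (x₂ : UnitAddTorus ι₂) (t : UnitAddTorus ι₁) =>
      mFourier (-k₁) t • G (Sum.elim t x₂)) := by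
    refine Continuous.smul ((mFourier (-k₁)).continuous.comp continuous_snd) (hG.comp ?_)
    exact continuous_sumElim.comp (continuous_snd.prodMk continuous_fst)
  have h := continuous_parametric_integral_of_continuous (μ := (volume : Measure (UnitAddTorus ι₁))) hF
    isCompact_univ
  simp only [Measure.restrict_univ] at h
  exact h

omit [Fintype ι₁] [Fintype ι₂] [DecidableEq ι₁] [DecidableEq ι₂] in
/-- The measurable equivalence `T^{ι₁ ⊕ ι₂} ≃ T^{ι₁} × T^{ι₂}` inverts to `(x₁, x₂) ↦ Sum.elim x₁ x₂`. [folklore] -/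
private theorem sumPiEquivProdPi_symm_apply' (q : UnitAddTorus ι₁ × UnitAddTorus ι₂) :
    (MeasurableEquiv.sumPiEquivProdPi (fun _ : ι₁ ⊕ ι₂ => UnitAddCircle)).symm q =
      (Sum.elim q.1 q.2 : UnitAddTorus (ι₁ ⊕ ι₂)) := by
  funext i
  cases i <;> rfl

omit [DecidableEq ι₁] [DecidableEq ι₂] [CompleteSpace V] in
/-- **Integration over `T^{ι₁ ⊕ ι₂}` is iterated integration over `T^{ι₁}` then `T^{ι₂}`** for a continuous
integrand (Fubini, through `volume_measurePreserving_sumPiEquivProdPi`). [cite: Grafakos2014, §3.1.1 (Fubini on `T^n = T^{n₁} × T^{n₂}`)] -/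
theorem integral_eq_integral_integral_sumElim {F : UnitAddTorus (ι₁ ⊕ ι₂) → V} (hF : Continuous F) :
    ∫ x, F x = ∫ x₂ : UnitAddTorus ι₂, ∫ x₁ : UnitAddTorus ι₁, F (Sum.elim x₁ x₂) := by
  set e := MeasurableEquiv.sumPiEquivProdPi (fun _ : ι₁ ⊕ ι₂ => UnitAddCircle) with he
  have hme : MeasurePreserving e.symm volume volume :=
    (volume_measurePreserving_sumPiEquivProdPi (fun _ : ι₁ ⊕ ι₂ => UnitAddCircle)).symm e
  rw [← hme.integral_comp' F]
  have hcont : Continuous fun q : UnitAddTorus ι₁ × UnitAddTorus ι₂ => F (e.symm q) := by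
    have : (fun q : UnitAddTorus ι₁ × UnitAddTorus ι₂ => F (e.symm q)) =
        fun q => F (Sum.elim q.1 q.2) := by
      funext q
      rw [sumPiEquivProdPi_symm_apply']
    rw [this]
    exact hF.comp continuous_sumElim
  have hint : Integrable (fun q : UnitAddTorus ι₁ × UnitAddTorus ι₂ => F (e.symm q)) (volume.prod volume) :=
    hcont.integrable_of_hasCompactSupport (HasCompactSupport.of_compactSpace _)
  rw [show (volume : Measure (UnitAddTorus ι₁ × UnitAddTorus ι₂)) = volume.prod volume from rfl,
    integral_prod_symm _ hint]
  refine integral_congr_ae (ae_of_all _ fun x₂ => integral_congr_ae (ae_of_all _ fun x₁ => ?_))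
  simp only []
  rw [sumPiEquivProdPi_symm_apply']

omit [DecidableEq ι₁] [DecidableEq ι₂] [CompleteSpace V] in
/-- **The Fourier coefficients of `G` are the coefficients of its partial coefficients**:
`𝓕G(k₁, k₂) = 𝓕_{T^{ι₂}}(fibreCoeff G k₁)(k₂)` for continuous `G`. [cite: Grafakos2014, §3.1.1] -/
theorem mFourierCoeff_sumElim {G : UnitAddTorus (ι₁ ⊕ ι₂) → V} (hG : Continuous G) (k₁ : ι₁ → ℤ) (k₂ : ι₂ → ℤ) :
    mFourierCoeff G (Sum.elim k₁ k₂) = mFourierCoeff (fibreCoeff G k₁) k₂ := by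
  have hF : Continuous fun x : UnitAddTorus (ι₁ ⊕ ι₂) => mFourier (-Sum.elim k₁ k₂) x • G x :=
    (mFourier _).continuous.smul hG
  rw [mFourierCoeff_eq_integral_volume, mFourierCoeff_eq_integral_volume,
    integral_eq_integral_integral_sumElim (F := fun x => mFourier (-Sum.elim k₁ k₂) x • G x) hF]
  refine integral_congr_ae (ae_of_all _ fun x₂ => ?_)
  dsimp only
  rw [fibreCoeff, ← integral_smul]
  refine integral_congr_ae (ae_of_all _ fun x₁ => ?_)
  dsimp only
  rw [neg_sumElim, mFourier_sumElim, mul_comm, mul_smul]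

omit [Fintype ι₁] [Fintype ι₂] [DecidableEq ι₁] [DecidableEq ι₂] in
/-- Every point of `T^{ι₁ ⊕ ι₂}` is `(x|ι₁, x|ι₂)`. [folklore] -/
private theorem sumElim_comp_eq (x : UnitAddTorus (ι₁ ⊕ ι₂)) :
    (Sum.elim (fun i => x (Sum.inl i)) (fun i => x (Sum.inr i)) : UnitAddTorus (ι₁ ⊕ ι₂)) = x := by
  funext i
  cases i <;> rfl

/-- For a smooth `G`, the coefficients `k₂ ↦ 𝓕G(k₁, k₂)` of a partial coefficient are absolutely summable.
[cite: Grafakos2014, Thm. 3.3.9] -/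
theorem summable_norm_mFourierCoeff_sumElim {G : UnitAddTorus (ι₁ ⊕ ι₂) → V} (hG : IsSmooth G) (k₁ : ι₁ → ℤ) :
    Summable fun k₂ : ι₂ → ℤ => ‖mFourierCoeff G (Sum.elim k₁ k₂)‖ := by
  have h := hG.rapidDecay_mFourierCoeff.summable_norm
  exact h.comp_injective (f := fun k => ‖mFourierCoeff G k‖) (i := fun k₂ => Sum.elim k₁ k₂)
    (fun a b hab => by simpa using congrArg (· ∘ Sum.inr) hab)

/-- **Fourier inversion on the base for the partial coefficients** of a smooth `G`:
`fibreCoeff G k₁ x₂ = Σ_{k₂} e_{k₂}(x₂) 𝓕G(k₁, k₂)`. [cite: Grafakos2014, Prop. 3.2.5] -/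
theorem fibreCoeff_eq_tsum {G : UnitAddTorus (ι₁ ⊕ ι₂) → V} (hG : IsSmooth G) (k₁ : ι₁ → ℤ) (x₂ : UnitAddTorus ι₂) :
    fibreCoeff G k₁ x₂ = ∑' k₂ : ι₂ → ℤ, mFourier k₂ x₂ • mFourierCoeff G (Sum.elim k₁ k₂) := by
  have hs := summable_norm_mFourierCoeff_sumElim hG k₁
  have hc1 : Continuous (fibreCoeff G k₁) := continuous_fibreCoeff hG.continuous k₁
  have hc2 : Continuous fun x₂ : UnitAddTorus ι₂ => ∑' k₂ : ι₂ → ℤ, mFourier k₂ x₂ • mFourierCoeff G (Sum.elim k₁ k₂) :=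
    continuous_tsum_mFourier_smul hs
  have hdiff := eq_zero_of_forall_mFourierCoeff_eq_zero (hc1.sub hc2) fun k₂ => by
    rw [mFourierCoeff_sub hc1.integrable_unitAddTorus hc2.integrable_unitAddTorus, ← mFourierCoeff_sumElim hG.continuous,
      mFourierCoeff_tsum_mFourier_smul hs, sub_self]
  have := congrFun hdiff x₂
  simpa [sub_eq_zero] using this

omit [Fintype ι₂] [DecidableEq ι₁] [DecidableEq ι₂] [CompleteSpace V] in
/-- `𝓕G(0, ·)` sums to the plain fibre integral: `fibreCoeff G 0 x₂ = ∫_{T^{ι₁}} G(t, x₂) dt`. [cite: Grafakos2014, §3.1.1] -/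
theorem fibreCoeff_zero (G : UnitAddTorus (ι₁ ⊕ ι₂) → V) (x₂ : UnitAddTorus ι₂) :
    fibreCoeff G 0 x₂ = ∫ t : UnitAddTorus ι₁, G (Sum.elim t x₂) := by
  simp only [fibreCoeff, neg_zero, mFourier_zero, ContinuousMap.one_apply, one_smul]

omit [DecidableEq ι₁] [DecidableEq ι₂] in
/-- **Partial synthesis**: for an absolutely summable family `c` on `ℤ^{ι₁ ⊕ ι₂}`,
`(Σ_k e_k c_k)(x₁, x₂) = Σ_{k₁} e_{k₁}(x₁) Σ_{k₂} e_{k₂}(x₂) c_{(k₁,k₂)}`. [cite: Grafakos2014, Prop. 3.2.5] -/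
theorem fourierSynth_sumElim {c : (ι₁ ⊕ ι₂ → ℤ) → V} (hc : Summable fun k => ‖c k‖) (x₁ : UnitAddTorus ι₁)
    (x₂ : UnitAddTorus ι₂) :
    fourierSynth c (Sum.elim x₁ x₂) =
      ∑' k₁ : ι₁ → ℤ, mFourier k₁ x₁ • ∑' k₂ : ι₂ → ℤ, mFourier k₂ x₂ • c (Sum.elim k₁ k₂) := by
  set E := (Equiv.sumArrowEquivProdArrow ι₁ ι₂ ℤ).symm with hE
  have hEq : ∀ q : (ι₁ → ℤ) × (ι₂ → ℤ), E q = Sum.elim q.1 q.2 := fun q => rfl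
  set f : (ι₁ → ℤ) × (ι₂ → ℤ) → V := fun q => (mFourier q.1 x₁ * mFourier q.2 x₂) • c (Sum.elim q.1 q.2) with hf
  have hnorm : ∀ q, ‖f q‖ = ‖c (E q)‖ := fun q => by
    rw [hf, hEq]
    simp only [norm_smul, norm_mul, norm_mFourier_apply, one_mul]
  have hsf : Summable f := by
    refine Summable.of_norm ?_
    have : Summable ((fun k => ‖c k‖) ∘ E) := (Equiv.summable_iff E).2 hc
    exact this.congr fun q => (hnorm q).symm
  have h1 : fourierSynth c (Sum.elim x₁ x₂) = ∑' q : (ι₁ → ℤ) × (ι₂ → ℤ), f q := by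
    rw [fourierSynth, ← Equiv.tsum_eq E]
    refine tsum_congr fun q => ?_
    rw [hEq, hf, mFourier_sumElim]
  rw [h1, hsf.tsum_prod]
  refine tsum_congr fun k₁ => ?_
  have hs₂ : Summable fun k₂ : ι₂ → ℤ => mFourier k₂ x₂ • c (Sum.elim k₁ k₂) := by
    refine Summable.of_norm ?_
    have hi : Summable fun k₂ : ι₂ → ℤ => ‖c (Sum.elim k₁ k₂)‖ :=
      hc.comp_injective (i := fun k₂ => Sum.elim k₁ k₂) (fun a b hab => by simpa using congrArg (· ∘ Sum.inr) hab)
    exact hi.congr fun k₂ => by rw [norm_smul, norm_mFourier_apply, one_mul]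
  rw [← hs₂.tsum_const_smul]
  refine tsum_congr fun k₂ => ?_
  rw [hf]
  simp only [mul_smul]

/-- **The fibre average is the fibre integral**: `(A G)(x₁, x₂) = ∫_{T^{ι₁}} G(t, x₂) dt` for smooth `G`.
[cite: Freitag1990, Ch. III §2, p. 145 («the coefficients do not depend on `x`»)] -/
theorem fibreAvg_apply {G : UnitAddTorus (ι₁ ⊕ ι₂) → V} (hG : IsSmooth G) (x₁ : UnitAddTorus ι₁) (x₂ : UnitAddTorus ι₂) :
    fibreAvg G (Sum.elim x₁ x₂) = ∫ t : UnitAddTorus ι₁, G (Sum.elim t x₂) := by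
  have hc := hG.rapidDecay_mFourierCoeff
  rw [fibreAvg, fourierSynth_sumElim hc.avgCoeff.summable_norm]
  rw [tsum_eq_single (0 : ι₁ → ℤ)]
  · rw [mFourier_zero, ContinuousMap.one_apply, one_smul, ← fibreCoeff_zero, fibreCoeff_eq_tsum hG]
    refine tsum_congr fun k₂ => ?_
    unfold avgCoeff
    rw [sumElim_comp_inl', if_pos rfl]
  · intro k₁ hk₁
    have : ∀ k₂ : ι₂ → ℤ, avgCoeff (mFourierCoeff G) (Sum.elim k₁ k₂) = 0 := fun k₂ => by
      unfold avgCoeff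
      rw [sumElim_comp_inl', if_neg hk₁]
    simp only [this, smul_zero, tsum_zero]

/-- The fibre average at a general point: `(A G)(x) = ∫_{T^{ι₁}} G(t, x|ι₂) dt`. [cite: Freitag1990, Ch. III §2, p. 145] -/
theorem fibreAvg_apply' {G : UnitAddTorus (ι₁ ⊕ ι₂) → V} (hG : IsSmooth G) (x : UnitAddTorus (ι₁ ⊕ ι₂)) :
    fibreAvg G x = ∫ t : UnitAddTorus ι₁, G (Sum.elim t fun i => x (Sum.inr i)) := by
  rw [← sumElim_comp_eq x, fibreAvg_apply hG, sumElim_comp_eq]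

/-- **Partial synthesis of the homotopy**: for smooth `G`,
`(K G)(x₁, x₂) = Σ_{k₁ ≠ 0} e_{k₁}(x₁) · (2πi)⁻¹ W_{k₁} ⌟ fibreCoeff G k₁ x₂`. [cite: BottTu1982Forms, §I.4] -/
theorem fibreHom_apply {p : ℕ} {W : (ι₁ → ℤ) → EuclideanSpace ℝ (ι₁ ⊕ ι₂)} (hW : PolyGrowth W)
    {G : UnitAddTorus (ι₁ ⊕ ι₂) → DForm (ι₁ ⊕ ι₂) (p + 1)} (hG : IsSmooth G) (x₁ : UnitAddTorus ι₁)
    (x₂ : UnitAddTorus ι₂) :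
    fibreHom W G (Sum.elim x₁ x₂) = ∑' k₁ : ι₁ → ℤ, mFourier k₁ x₁ •
      (if k₁ = 0 then (0 : DForm (ι₁ ⊕ ι₂) p)
        else (2 * Real.pi * I : ℂ)⁻¹ • (fibreCoeff G k₁ x₂).curryLeft (W k₁)) := by
  have hc := hG.rapidDecay_mFourierCoeff
  rw [fibreHom, fourierSynth_sumElim (hc.homCoeff hW).summable_norm]
  refine tsum_congr fun k₁ => ?_
  congr 1
  by_cases hk₁ : k₁ = 0
  · rw [if_pos hk₁]
    have h0 : ∀ k₂ : ι₂ → ℤ, mFourier k₂ x₂ • homCoeff W (mFourierCoeff G) (Sum.elim k₁ k₂) = 0 := fun k₂ => by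
      unfold homCoeff
      rw [sumElim_comp_inl', if_pos hk₁, smul_zero]
    simp only [h0, tsum_zero]
  · rw [if_neg hk₁]
    have hterm : ∀ k₂ : ι₂ → ℤ, mFourier k₂ x₂ • homCoeff W (mFourierCoeff G) (Sum.elim k₁ k₂) =
        (2 * Real.pi * I : ℂ)⁻¹ • (curryLeftL (𝕜' := ℂ) (W k₁))
          (mFourier k₂ x₂ • mFourierCoeff G (Sum.elim k₁ k₂)) := fun k₂ => by
      unfold homCoeff
      rw [sumElim_comp_inl', if_neg hk₁, curryLeftL_apply, curryLeft_smul', smul_comm]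
    simp_rw [hterm]
    have hs₂ : Summable fun k₂ : ι₂ → ℤ => mFourier k₂ x₂ • mFourierCoeff G (Sum.elim k₁ k₂) := by
      refine Summable.of_norm ((summable_norm_mFourierCoeff_sumElim hG k₁).congr fun k₂ => ?_)
      rw [norm_smul, norm_mFourier_apply, one_mul]
    rw [tsum_const_smul'', ← ContinuousLinearMap.map_tsum _ hs₂, curryLeftL_apply, ← fibreCoeff_eq_tsum hG]

omit [Fintype ι₂] [DecidableEq ι₁] [DecidableEq ι₂] [CompleteSpace V] in
/-- The partial coefficients of `φ(x₂) · G` are `φ(x₂) · fibreCoeff G`. [cite: Grafakos2014, §3.1.1] -/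
theorem fibreCoeff_smul_left (φ : UnitAddTorus ι₂ → ℂ) (G : UnitAddTorus (ι₁ ⊕ ι₂) → V) (k₁ : ι₁ → ℤ)
    (x₂ : UnitAddTorus ι₂) :
    fibreCoeff (fun x => φ (fun i => x (Sum.inr i)) • G x) k₁ x₂ = φ x₂ • fibreCoeff G k₁ x₂ := by
  simp only [fibreCoeff, Sum.elim_inr]
  rw [← integral_smul]
  refine integral_congr_ae (ae_of_all _ fun t => ?_)
  dsimp only
  rw [smul_comm]

/-- **`C^∞(T^{ι₂})`-LINEARITY OF THE HOMOTOPY**: for a function `φ` of the base variable only,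
`K(φ · G) = φ · K G` — the homotopy operator acts fibre by fibre. [cite: BottTu1982Forms, §I.4] -/
theorem fibreHom_smul_left {p : ℕ} {W : (ι₁ → ℤ) → EuclideanSpace ℝ (ι₁ ⊕ ι₂)} (hW : PolyGrowth W)
    {G : UnitAddTorus (ι₁ ⊕ ι₂) → DForm (ι₁ ⊕ ι₂) (p + 1)} (hG : IsSmooth G) {φ : UnitAddTorus ι₂ → ℂ}
    (hφG : IsSmooth fun x : UnitAddTorus (ι₁ ⊕ ι₂) => φ (fun i => x (Sum.inr i)) • G x)
    (x : UnitAddTorus (ι₁ ⊕ ι₂)) :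
    fibreHom W (fun x => φ (fun i => x (Sum.inr i)) • G x) x = φ (fun i => x (Sum.inr i)) • fibreHom W G x := by
  rw [← sumElim_comp_eq x, fibreHom_apply hW hφG, fibreHom_apply hW hG]
  simp only [Sum.elim_inr]
  rw [← tsum_const_smul'']
  refine tsum_congr fun k₁ => ?_
  by_cases hk₁ : k₁ = 0
  · simp [hk₁]
  · rw [if_neg hk₁, if_neg hk₁, fibreCoeff_smul_left, curryLeft_smul', smul_smul, smul_smul, smul_smul, smul_smul]
    congr 1
    ring

/-- The fibre average is `C(T^{ι₂})`-linear: `A(φ · G) = φ · A G`. [cite: Freitag1990, Ch. III §2, p. 145] -/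
theorem fibreAvg_smul_left {G : UnitAddTorus (ι₁ ⊕ ι₂) → V} (hG : IsSmooth G) {φ : UnitAddTorus ι₂ → ℂ}
    (hφG : IsSmooth fun x : UnitAddTorus (ι₁ ⊕ ι₂) => φ (fun i => x (Sum.inr i)) • G x)
    (x : UnitAddTorus (ι₁ ⊕ ι₂)) :
    fibreAvg (fun x => φ (fun i => x (Sum.inr i)) • G x) x = φ (fun i => x (Sum.inr i)) • fibreAvg G x := by
  rw [fibreAvg_apply' hφG, fibreAvg_apply' hG]
  simp only [Sum.elim_inr]
  rw [← integral_smul]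

/-- **LOCALITY**: if `G` vanishes on the fibre over `x|ι₂`, so does `K G` there. [cite: BottTu1982Forms, §I.4] -/
theorem fibreHom_apply_eq_zero_of_forall {p : ℕ} {W : (ι₁ → ℤ) → EuclideanSpace ℝ (ι₁ ⊕ ι₂)} (hW : PolyGrowth W)
    {G : UnitAddTorus (ι₁ ⊕ ι₂) → DForm (ι₁ ⊕ ι₂) (p + 1)} (hG : IsSmooth G) {x₂ : UnitAddTorus ι₂}
    (h0 : ∀ t : UnitAddTorus ι₁, G (Sum.elim t x₂) = 0) (x₁ : UnitAddTorus ι₁) :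
    fibreHom W G (Sum.elim x₁ x₂) = 0 := by
  rw [fibreHom_apply hW hG]
  have h1 : ∀ k₁ : ι₁ → ℤ, fibreCoeff G k₁ x₂ = 0 := fun k₁ => by
    simp only [fibreCoeff, h0, smul_zero, integral_zero]
  have h2 : ∀ k₁ : ι₁ → ℤ, (mFourier k₁ x₁ • (if k₁ = 0 then (0 : DForm (ι₁ ⊕ ι₂) p)
      else (2 * Real.pi * I : ℂ)⁻¹ • (fibreCoeff G k₁ x₂).curryLeft (W k₁))) = 0 := fun k₁ => by
    split_ifs
    · rw [smul_zero]
    · rw [h1, curryLeft_zero, _root_.zero_apply, smul_zero, smul_zero]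
  simp only [h2, tsum_zero]

end Fibre

end Torus

end Literature.Analysis.FunctionSpaces
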